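import Mathlib
import HarnessLib
import Summits.HubbardSuperconductivity.HubbardSuperconductivity.Theorems.KLProgrammeKLRegimeFlowShellJets
import Summits.HubbardSuperconductivity.HubbardSuperconductivity.Theorems.KLProgrammeSalmhoferCutoffSecondDerivSharp
import Summits.HubbardSuperconductivity.HubbardSuperconductivity.Theorems.KLProgrammeSalmhoferCutoffFourthDerivBound
import Summits.HubbardSuperconductivity.HubbardSuperconductivity.Theorems.KLProgrammeKLRegimeSplitFrameFn

/-!
# Route `KLProgramme`, crux K3 — engine-flow child (stmt-HubbardSuperconductivity-20437), stub (C) `stub_twoLeg_curvature`, (C1) door v2, FAR part: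
# THE FLAT TUBE CUTOFF ALONG A DISPLACED CURVE — numerals for the profile `ξ ↦ 1 − χ₂(ξ²/(4R²))` and the Bell bound `Bell(X; φ̄(w))`

Cell gate-hubbard-kl, seat hubbard-kl-k3c3-p3 (g6); `need:` (2) of k3c3-p1 g6 (KL STATUS 2026-08-27T15:20:47Z): ONE lemma bounding the jets of
`θ ↦ klFlatCutoffFn μ (ofLp (γθ − w))` (the flat tube cutoff of `klFrameExtFn` read along a displaced curve) by a Bell polynomial in PROVED numerals
`X_l ≥ sup|∂^l_ξ[1 − χ₂(ξ²/(4·klFlatR²))]|` and the displaced band jets `φ̄_j(w)` of `…FlowShellJets.freeBand_displaced_jets`.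
* §1 the band-energy profile `ξ ↦ 1 − χ₂(100ξ²)` (`klFlatR = 1/20`): outside `|ξ| ≤ 1/10` every derivative vanishes (`χ₂ ≡ 1` there); on
  `|ξ| ≤ 1/10` the composition bounds of `…PerturbedFermiCurveCompChainStruct` with the χ₂ numerals `|χ₂′| ≤ 8/3`, `‖D²χ₂‖ ≤ 176/9`
  (`…SalmhoferCutoffSecondDerivSharp`), `‖D³χ₂‖ ≤ 44900`, `‖D⁴χ₂‖ ≤ 3960000` and the inner jets `|200ξ| ≤ 20`, `200`, `0`, `0` give
  **`flatProfile_jets_le`**: `X = (160/3, 75200/9, 3.6·10⁸, 6.56·10¹¹)` [exact sups ≈ (43, 5.7·10³, 1.7·10⁶, 9.4·10⁸), k3c3-p1's memo: orders 3–4 here are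
  crude by the factors of the tree's χ₂‴, χ₂⁗ numerals];
* §2 **`abs_iteratedDeriv_flatCutoff_comp_curve_sub_le`**: `|∂ᵏ[θ ↦ klFlatCutoffFn μ (ofLp (γθ − w))](θ)| ≤ Bell_k(X; φ̄(w))`, `k = 1 … 4`, with
  `φ̄₁ = β₁ + 4‖w‖D₁`, `φ̄₂ = β₂ + 4‖w‖(D₁² + D₂)`, `φ̄₃ = β₃ + 4‖w‖(D₁³ + 3D₁D₂ + D₃)`, `φ̄₄ = β₄ + 4‖w‖(D₁⁴ + 6D₁²D₂ + 3D₂² + 4D₁D₃ + D₄)`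
  (`β_j` = jets of the frame's own band profile `ε∘γ − μ`, `D_i` = curve jets) — every Bell term carries a factor `φ̄`.
Pure analysis + the tree's numerals; nothing about superconductivity. [cite: Salmhofer1999, §4.2.5 (4.71)]
-/

noncomputable section

namespace Summit.HubbardSuperconductivity.HubbardSuperconductivity.Theorems.PerturbedFermiCurve

set_option linter.dupNamespace false -- summit = problem name (single-conjunct summit), D-0017
set_option maxSynthPendingDepth 3 -- nested operator-norm instances

open Real Set Filter Literature.MathematicalPhysics.QuantumLattice
open Summit.HubbardSuperconductivity.HubbardSuperconductivity.Theorems.KLRegimeSplit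
open scoped Topology

/-! ## §1 The band-energy profile `ξ ↦ 1 − χ₂(ξ²/(4R²))` -/

/-- `4·klFlatR² = 1/100`. -/
theorem four_mul_klFlatR_sq : 4 * klFlatR ^ 2 = 1 / 100 := by unfold klFlatR; norm_num

/-- The inner map is `ξ ↦ 100ξ²`. -/
theorem flatInner_eq : (fun ξ : ℝ => ξ ^ 2 / (4 * klFlatR ^ 2)) = fun ξ => 100 * ξ ^ 2 := by
  funext ξ; rw [four_mul_klFlatR_sq]; ring

/-- The profile is smooth. -/
theorem contDiff_flatProfile {n : ℕ∞} : ContDiff ℝ n (fun ξ : ℝ => 1 - salmhoferCutoff (ξ ^ 2 / (4 * klFlatR ^ 2))) :=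
  contDiff_const.sub (contDiff_salmhoferCutoff.comp ((contDiff_id.pow 2).div_const _))

/-- The profile is `1 − (χ₂ ∘ inner)`. -/
theorem flatProfile_eq_comp : (fun ξ : ℝ => 1 - salmhoferCutoff (ξ ^ 2 / (4 * klFlatR ^ 2))) =
    fun ξ => 1 - (salmhoferCutoff ∘ fun ξ : ℝ => 100 * ξ ^ 2) ξ := by
  funext ξ; simp only [Function.comp_apply, four_mul_klFlatR_sq]; ring_nf

/-- Jets of the inner map: `∂(100ξ²) = 200ξ`, `∂² = 200`, `∂³ = ∂⁴ = 0`. -/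
theorem iteratedDeriv_flatInner (ξ : ℝ) :
    iteratedDeriv 1 (fun ξ : ℝ => 100 * ξ ^ 2) ξ = 200 * ξ ∧ iteratedDeriv 2 (fun ξ : ℝ => 100 * ξ ^ 2) ξ = 200 ∧
    iteratedDeriv 3 (fun ξ : ℝ => 100 * ξ ^ 2) ξ = 0 ∧ iteratedDeriv 4 (fun ξ : ℝ => 100 * ξ ^ 2) ξ = 0 := by
  have d1 : deriv (fun ξ : ℝ => 100 * ξ ^ 2) = fun ξ => 200 * ξ := by
    funext x
    have h : HasDerivAt (fun ξ : ℝ => 100 * ξ ^ 2) (100 * (2 * x ^ 1 * 1)) x := ((hasDerivAt_id x).pow 2).const_mul 100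
    rw [h.deriv]; ring
  have d2 : deriv (fun ξ : ℝ => 200 * ξ) = fun _ => (200 : ℝ) := by
    funext x
    have h : HasDerivAt (fun ξ : ℝ => 200 * ξ) (200 * 1) x := (hasDerivAt_id x).const_mul 200
    rw [h.deriv]; ring
  have d3 : deriv (fun _ : ℝ => (200 : ℝ)) = fun _ => 0 := by funext x; exact deriv_const x _
  have e1 : iteratedDeriv 1 (fun ξ : ℝ => 100 * ξ ^ 2) = fun ξ => 200 * ξ := by rw [iteratedDeriv_one, d1]
  have e2 : iteratedDeriv 2 (fun ξ : ℝ => 100 * ξ ^ 2) = fun _ => (200 : ℝ) := by rw [iteratedDeriv_succ, e1, d2]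
  have e3 : iteratedDeriv 3 (fun ξ : ℝ => 100 * ξ ^ 2) = fun _ => (0 : ℝ) := by rw [iteratedDeriv_succ, e2, d3]
  have e4 : iteratedDeriv 4 (fun ξ : ℝ => 100 * ξ ^ 2) = fun _ => (0 : ℝ) := by
    rw [iteratedDeriv_succ, e3]; funext x; exact deriv_const x _
  exact ⟨by rw [e1], by rw [e2], by rw [e3], by rw [e4]⟩

/-- The inner map is smooth. -/
theorem contDiff_flatInner {n : ℕ∞} : ContDiff ℝ n (fun ξ : ℝ => 100 * ξ ^ 2) := contDiff_const.mul (contDiff_id.pow 2)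

/-- The χ₂ numerals in `iteratedFDeriv` currency: `(8/3, 176/9, 44900, 3960000)` at orders `1 … 4`. -/
theorem salmhoferCutoff_sizes (y : ℝ) :
    ‖iteratedFDeriv ℝ 1 salmhoferCutoff y‖ ≤ 8 / 3 ∧ ‖iteratedFDeriv ℝ 2 salmhoferCutoff y‖ ≤ 176 / 9 ∧
    ‖iteratedFDeriv ℝ 3 salmhoferCutoff y‖ ≤ 44900 ∧ ‖iteratedFDeriv ℝ 4 salmhoferCutoff y‖ ≤ 3960000 := by
  refine ⟨?_, norm_iteratedFDeriv_two_salmhoferCutoff_le_sharp y, norm_iteratedFDeriv_three_salmhoferCutoff_le y,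
    norm_iteratedFDeriv_four_salmhoferCutoff_le y⟩
  rw [norm_iteratedFDeriv_eq_norm_iteratedDeriv, iteratedDeriv_one, Real.norm_eq_abs]
  exact klsh_abs_deriv_salmhoferCutoff_le y

/-- On the zone `|ξ| ≤ 1/10`: the Bell bounds for `χ₂ ∘ (100ξ²)`. -/
theorem abs_iteratedDeriv_salmhoferCutoff_comp_inner_le {ξ : ℝ} (hξ : |ξ| ≤ 1 / 10) :
    |iteratedDeriv 1 (salmhoferCutoff ∘ fun ξ : ℝ => 100 * ξ ^ 2) ξ| ≤ 160 / 3 ∧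
    |iteratedDeriv 2 (salmhoferCutoff ∘ fun ξ : ℝ => 100 * ξ ^ 2) ξ| ≤ 75200 / 9 ∧
    |iteratedDeriv 3 (salmhoferCutoff ∘ fun ξ : ℝ => 100 * ξ ^ 2) ξ| ≤ 360000000 ∧
    |iteratedDeriv 4 (salmhoferCutoff ∘ fun ξ : ℝ => 100 * ξ ^ 2) ξ| ≤ 656000000000 := by
  have hF : ContDiff ℝ 4 salmhoferCutoff := contDiff_salmhoferCutoff
  have hq : ContDiff ℝ 4 (fun ξ : ℝ => 100 * ξ ^ 2) := contDiff_flatInner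
  obtain ⟨m1, m2, m3, m4⟩ := salmhoferCutoff_sizes ((fun ξ : ℝ => 100 * ξ ^ 2) ξ)
  obtain ⟨q1, q2, q3, q4⟩ := iteratedDeriv_flatInner ξ
  have hD₁ : ‖iteratedDeriv 1 (fun ξ : ℝ => 100 * ξ ^ 2) ξ‖ ≤ 20 := by
    rw [q1, Real.norm_eq_abs, abs_mul, abs_of_pos (by norm_num : (0:ℝ) < 200)]; linarith
  have hD₂ : ‖iteratedDeriv 2 (fun ξ : ℝ => 100 * ξ ^ 2) ξ‖ ≤ 200 := by rw [q2]; norm_num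
  have hD₃ : ‖iteratedDeriv 3 (fun ξ : ℝ => 100 * ξ ^ 2) ξ‖ ≤ 0 := by rw [q3, norm_zero]
  have hD₄ : ‖iteratedDeriv 4 (fun ξ : ℝ => 100 * ξ ^ 2) ξ‖ ≤ 0 := by rw [q4, norm_zero]
  refine ⟨(abs_iteratedDeriv_one_comp_le_struct hF hq m1 hD₁).trans (by norm_num),
    (abs_iteratedDeriv_two_comp_le_struct hF hq m1 m2 hD₁ hD₂).trans (by norm_num),
    (abs_iteratedDeriv_three_comp_le_struct hF hq m1 m2 m3 hD₁ hD₂ hD₃).trans (by norm_num),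
    (abs_iteratedDeriv_four_comp_le_struct hF hq m1 m2 m3 m4 hD₁ hD₂ hD₃ hD₄).trans (by norm_num)⟩

/-- Off the zone (`1/10 < |ξ|`): the profile is locally `0`, so every derivative of positive order vanishes. -/
theorem iteratedDeriv_flatProfile_eq_zero_of_lt {ξ : ℝ} (hξ : 1 / 10 < |ξ|) {k : ℕ} (hk : 1 ≤ k) :
    iteratedDeriv k (fun ξ : ℝ => 1 - salmhoferCutoff (ξ ^ 2 / (4 * klFlatR ^ 2))) ξ = 0 := by
  have hopen : IsOpen {x : ℝ | 1 / 10 < |x|} := isOpen_lt continuous_const continuous_abs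
  have hev : (fun ξ : ℝ => 1 - salmhoferCutoff (ξ ^ 2 / (4 * klFlatR ^ 2))) =ᶠ[𝓝 ξ] fun _ => (0 : ℝ) := by
    filter_upwards [hopen.mem_nhds hξ] with x hx
    have hx' : (1 : ℝ) ≤ x ^ 2 / (4 * klFlatR ^ 2) := by
      rw [four_mul_klFlatR_sq]
      have h2 : (1 / 10 : ℝ) ^ 2 < |x| ^ 2 := by
        exact pow_lt_pow_left₀ hx (by norm_num) (by norm_num)
      rw [sq_abs] at h2
      rw [le_div_iff₀ (by norm_num)]; nlinarith
    show 1 - salmhoferCutoff (x ^ 2 / (4 * klFlatR ^ 2)) = 0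
    rw [salmhoferCutoff_of_ge hx', sub_self]
  rw [hev.iteratedDeriv_eq, iteratedDeriv_const, if_neg (by omega)]

/-- **The profile's numerals**: for every `ξ`, `|∂¹| ≤ 160/3`, `|∂²| ≤ 75200/9`, `|∂³| ≤ 3.6·10⁸`, `|∂⁴| ≤ 6.56·10¹¹`. -/
theorem abs_iteratedDeriv_flatProfile_le (ξ : ℝ) :
    |iteratedDeriv 1 (fun ξ : ℝ => 1 - salmhoferCutoff (ξ ^ 2 / (4 * klFlatR ^ 2))) ξ| ≤ 160 / 3 ∧
    |iteratedDeriv 2 (fun ξ : ℝ => 1 - salmhoferCutoff (ξ ^ 2 / (4 * klFlatR ^ 2))) ξ| ≤ 75200 / 9 ∧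
    |iteratedDeriv 3 (fun ξ : ℝ => 1 - salmhoferCutoff (ξ ^ 2 / (4 * klFlatR ^ 2))) ξ| ≤ 360000000 ∧
    |iteratedDeriv 4 (fun ξ : ℝ => 1 - salmhoferCutoff (ξ ^ 2 / (4 * klFlatR ^ 2))) ξ| ≤ 656000000000 := by
  rcases le_or_gt |ξ| (1 / 10) with hξ | hξ
  · -- zone: `1 − (χ₂ ∘ inner)`, derivatives are minus those of the composition
    have hneg : ∀ {k : ℕ}, 1 ≤ k → iteratedDeriv k (fun ξ : ℝ => 1 - salmhoferCutoff (ξ ^ 2 / (4 * klFlatR ^ 2))) ξ =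
        -iteratedDeriv k (salmhoferCutoff ∘ fun ξ : ℝ => 100 * ξ ^ 2) ξ := by
      intro k hk
      rw [flatProfile_eq_comp, iteratedDeriv_const_sub (by omega), iteratedDeriv_neg]
    obtain ⟨b1, b2, b3, b4⟩ := abs_iteratedDeriv_salmhoferCutoff_comp_inner_le hξ
    refine ⟨?_, ?_, ?_, ?_⟩ <;> rw [hneg (by norm_num), abs_neg] <;> assumption
  · rw [iteratedDeriv_flatProfile_eq_zero_of_lt hξ le_rfl, iteratedDeriv_flatProfile_eq_zero_of_lt hξ (by norm_num),
      iteratedDeriv_flatProfile_eq_zero_of_lt hξ (by norm_num), iteratedDeriv_flatProfile_eq_zero_of_lt hξ (by norm_num), abs_zero]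
    norm_num

/-- The same in `iteratedFDeriv` currency (ready for the composition bounds). -/
theorem flatProfile_jets_le (ξ : ℝ) :
    ‖iteratedFDeriv ℝ 1 (fun ξ : ℝ => 1 - salmhoferCutoff (ξ ^ 2 / (4 * klFlatR ^ 2))) ξ‖ ≤ 160 / 3 ∧
    ‖iteratedFDeriv ℝ 2 (fun ξ : ℝ => 1 - salmhoferCutoff (ξ ^ 2 / (4 * klFlatR ^ 2))) ξ‖ ≤ 75200 / 9 ∧
    ‖iteratedFDeriv ℝ 3 (fun ξ : ℝ => 1 - salmhoferCutoff (ξ ^ 2 / (4 * klFlatR ^ 2))) ξ‖ ≤ 360000000 ∧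
    ‖iteratedFDeriv ℝ 4 (fun ξ : ℝ => 1 - salmhoferCutoff (ξ ^ 2 / (4 * klFlatR ^ 2))) ξ‖ ≤ 656000000000 := by
  obtain ⟨a1, a2, a3, a4⟩ := abs_iteratedDeriv_flatProfile_le ξ
  simp only [norm_iteratedFDeriv_eq_norm_iteratedDeriv, Real.norm_eq_abs]
  exact ⟨a1, a2, a3, a4⟩

/-! ## §2 The flat tube cutoff along a displaced curve -/

section Curve

variable (μ : ℝ) {γ : ℝ → Momentum} (hγ : ContDiff ℝ 4 γ) (w : Momentum) {θ D₁ D₂ D₃ D₄ β₁ β₂ β₃ β₄ : ℝ}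
  (hD₁ : ‖iteratedDeriv 1 γ θ‖ ≤ D₁) (hD₂ : ‖iteratedDeriv 2 γ θ‖ ≤ D₂) (hD₃ : ‖iteratedDeriv 3 γ θ‖ ≤ D₃) (hD₄ : ‖iteratedDeriv 4 γ θ‖ ≤ D₄)
  (hβ₁ : |iteratedDeriv 1 (fun θ : ℝ => squareDispersion 1 0 (γ θ) - μ) θ| ≤ β₁)
  (hβ₂ : |iteratedDeriv 2 (fun θ : ℝ => squareDispersion 1 0 (γ θ) - μ) θ| ≤ β₂)
  (hβ₃ : |iteratedDeriv 3 (fun θ : ℝ => squareDispersion 1 0 (γ θ) - μ) θ| ≤ β₃)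
  (hβ₄ : |iteratedDeriv 4 (fun θ : ℝ => squareDispersion 1 0 (γ θ) - μ) θ| ≤ β₄)

/-- The flat cutoff read on `Momentum` is the profile of the displaced band. -/
theorem klFlatCutoffFn_ofLp_eq (q : Momentum) :
    klFlatCutoffFn μ (WithLp.ofLp q) = (fun ξ : ℝ => 1 - salmhoferCutoff (ξ ^ 2 / (4 * klFlatR ^ 2))) (squareDispersion 1 0 q - μ) := by
  simp only [klFlatCutoffFn, squareDispersion_one_zero_eq_sqDispersion]
  rfl

include hγ hD₁ hD₂ hD₃ hD₄ hβ₁ hβ₂ hβ₃ hβ₄ in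
/-- **THE FLAT CUTOFF ALONG THE DISPLACED CURVE `γ − w`** (`need:` (2) of k3c3-p1 g6): with `X = (160/3, 75200/9, 3.6·10⁸, 6.56·10¹¹)` and the
displaced band jets `φ̄_j(w)` of `freeBand_displaced_jets`,
`|∂ᵏ[θ ↦ klFlatCutoffFn μ (ofLp (γθ − w))](θ)| ≤ Bell_k(X; φ̄(w))`, `k = 1 … 4` — every term carries a factor `φ̄`. -/
theorem abs_iteratedDeriv_flatCutoff_comp_curve_sub_le :
    |iteratedDeriv 1 (fun θ : ℝ => klFlatCutoffFn μ (WithLp.ofLp (γ θ - w))) θ| ≤ 160 / 3 * (β₁ + 4 * ‖w‖ * D₁) ∧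
    |iteratedDeriv 2 (fun θ : ℝ => klFlatCutoffFn μ (WithLp.ofLp (γ θ - w))) θ| ≤
      75200 / 9 * (β₁ + 4 * ‖w‖ * D₁) ^ 2 + 160 / 3 * (β₂ + 4 * ‖w‖ * (D₁ ^ 2 + D₂)) ∧
    |iteratedDeriv 3 (fun θ : ℝ => klFlatCutoffFn μ (WithLp.ofLp (γ θ - w))) θ| ≤
      360000000 * (β₁ + 4 * ‖w‖ * D₁) ^ 3 + 3 * (75200 / 9) * (β₁ + 4 * ‖w‖ * D₁) * (β₂ + 4 * ‖w‖ * (D₁ ^ 2 + D₂)) +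
        160 / 3 * (β₃ + 4 * ‖w‖ * (D₁ ^ 3 + 3 * D₁ * D₂ + D₃)) ∧
    |iteratedDeriv 4 (fun θ : ℝ => klFlatCutoffFn μ (WithLp.ofLp (γ θ - w))) θ| ≤
      656000000000 * (β₁ + 4 * ‖w‖ * D₁) ^ 4 + 6 * 360000000 * (β₁ + 4 * ‖w‖ * D₁) ^ 2 * (β₂ + 4 * ‖w‖ * (D₁ ^ 2 + D₂)) +
        3 * (75200 / 9) * (β₂ + 4 * ‖w‖ * (D₁ ^ 2 + D₂)) ^ 2 +
        4 * (75200 / 9) * (β₁ + 4 * ‖w‖ * D₁) * (β₃ + 4 * ‖w‖ * (D₁ ^ 3 + 3 * D₁ * D₂ + D₃)) +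
        160 / 3 * (β₄ + 4 * ‖w‖ * (D₁ ^ 4 + 6 * D₁ ^ 2 * D₂ + 3 * D₂ ^ 2 + 4 * D₁ * D₃ + D₄)) := by
  -- the function is `profile ∘ φ_w`
  have hfun : (fun θ : ℝ => klFlatCutoffFn μ (WithLp.ofLp (γ θ - w))) =
      (fun ξ : ℝ => 1 - salmhoferCutoff (ξ ^ 2 / (4 * klFlatR ^ 2))) ∘ fun θ : ℝ => squareDispersion 1 0 (γ θ - w) - μ := by
    funext θ; rw [Function.comp_apply, klFlatCutoffFn_ofLp_eq]
  obtain ⟨hφ, p1, p2, p3, p4⟩ := freeBand_displaced_jets μ hγ w hD₁ hD₂ hD₃ hD₄ hβ₁ hβ₂ hβ₃ hβ₄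
  have hχ : ContDiff ℝ 4 (fun ξ : ℝ => 1 - salmhoferCutoff (ξ ^ 2 / (4 * klFlatR ^ 2))) := contDiff_flatProfile
  obtain ⟨m1, m2, m3, m4⟩ := flatProfile_jets_le ((fun θ : ℝ => squareDispersion 1 0 (γ θ - w) - μ) θ)
  have n1 : ‖iteratedDeriv 1 (fun θ : ℝ => squareDispersion 1 0 (γ θ - w) - μ) θ‖ ≤ β₁ + 4 * ‖w‖ * D₁ := by
    rw [Real.norm_eq_abs]; exact p1
  have n2 : ‖iteratedDeriv 2 (fun θ : ℝ => squareDispersion 1 0 (γ θ - w) - μ) θ‖ ≤ β₂ + 4 * ‖w‖ * (D₁ ^ 2 + D₂) := by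
    rw [Real.norm_eq_abs]; exact p2
  have n3 : ‖iteratedDeriv 3 (fun θ : ℝ => squareDispersion 1 0 (γ θ - w) - μ) θ‖ ≤ β₃ + 4 * ‖w‖ * (D₁ ^ 3 + 3 * D₁ * D₂ + D₃) := by
    rw [Real.norm_eq_abs]; exact p3
  have n4 : ‖iteratedDeriv 4 (fun θ : ℝ => squareDispersion 1 0 (γ θ - w) - μ) θ‖ ≤
      β₄ + 4 * ‖w‖ * (D₁ ^ 4 + 6 * D₁ ^ 2 * D₂ + 3 * D₂ ^ 2 + 4 * D₁ * D₃ + D₄) := by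
    rw [Real.norm_eq_abs]; exact p4
  rw [hfun]
  exact ⟨abs_iteratedDeriv_one_comp_le_struct hχ hφ m1 n1, abs_iteratedDeriv_two_comp_le_struct hχ hφ m1 m2 n1 n2,
    abs_iteratedDeriv_three_comp_le_struct hχ hφ m1 m2 m3 n1 n2 n3,
    abs_iteratedDeriv_four_comp_le_struct hχ hφ m1 m2 m3 m4 n1 n2 n3 n4⟩

end Curve

end Summit.HubbardSuperconductivity.HubbardSuperconductivity.Theorems.PerturbedFermiCurve

end
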